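import Summits.HodgeConjecture.HodgeConjecture.Theorems.K2E3UnitaryParabolicLeviPart
import Literature.NumberTheory.Automorphic.GLnTwoBlockLeviStructure
import Literature.NumberTheory.Automorphic.UnipotentRadicalCompactOpenProofs
import HarnessLib

/-!
# K2 ∕ E3 «EllipticInputs», 13a road A, J4 (ii)-nest: COARSENING of block labellings — `P_S ≤ P_{S'}`, `M_S ≤ M_{S'}`, `N_{S'} ≤ N_S`, the NEST
# `N_S = (N_S ∩ M_{S'}) · N_{S'}` and the Levi triple `P_S ∩ M_{S'} = M_S ⋉ (N_S ∩ M_{S'})` inside a unitary group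

Cell `hodgecm-mathlib` (Track B «K2-LIT»), item h413 = `stmt-HodgeConjecture-24833`; author K2E3-p10 (g2); count-neutral helper for the 13a line
(road A; DRIVER ★ `K2E3LocalIrrepAdmissibleOfConeInputs`: the Levi triples `s i j : ParabolicTriple ↥(t i).M` and the binder
`hnest : n ∈ (t j).N → ∃ n' : (t i).M, n' ∈ (s i j).N ∧ ∃ n'' ∈ (t i).N, n = n' * n''` for `j < i`, i.e. `S_j ⊆ S_i`).
PROOF lane: theorems only (no `def`, no `instance`, no `sorry`), GENERIC in a pair of labellings `c : n → α` (fine; `wittBlockOn e S`) and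
`c' : n → β` (coarse; `wittBlockOn e S'`, `S ⊆ S'`) related by the single hypothesis `hmono : ∀ k l, c k ≤ c l → c' k ≤ c' l`
(K2-defs1's labelling lemma), in the comap currency of ★ `K2E3UnitaryParabolicLeviPart` ∕ ★ `K2E3LocalUnitaryWittParabolicDefs`.

* §1 (GL level) `standardParabolicGL_le_of_coarsening`, `standardLeviGL_le_of_coarsening`, `unipotentRadicalGL_le_of_coarsening` (`U_{c'} ≤ U_c`),
  `leviPart_mem_unipotentRadicalGL_of_coarsening` (the `c'`-Levi part of `u ∈ U_c` lies in `U_c`).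
* §2 (inside `U = U(σ, J)`, `J` anti-block for `c'`) **`exists_nest`**: every `n ∈ N_S ∩ U` is `n'·n''` with `n' ∈ N_S ∩ M_{S'} ∩ U`, `n'' ∈ N_{S'} ∩ U`;
  **`exists_nest_of_eq`**: the same in the DRIVER's shape for any `t' : ParabolicTriple ↥U`, `s : ParabolicTriple ↥t'.M` with `rfl`∕`iff`-shaped side
  conditions on `t'.M`, `t'.N`, `s.N`.
* §3 (inside `↥(M_{S'} ∩ U)`, `J` anti-block for `c`) **`isComplement'_leviTriple`**, **`le_normalizer_leviTriple`**: the two proof fields of the Levi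
  triple `(P_S ∩ M_{S'}, M_S, N_S ∩ M_{S'})` of `M_{S'} ∩ U`, in `subgroupOf` currency.

References: I. N. Bernstein, A. V. Zelevinsky (1977), §2.1–§2.3 (nested standard parabolics of `GL_n`, `U_β = (U_β ∩ M_γ)·U_γ`); W. Casselman (1995), Prop. 1.4.4;
A. Borel, *Linear Algebraic Groups* (1991), §23.
-/

set_option autoImplicit false
set_option linter.dupNamespace false

namespace Summit.HodgeConjecture.HodgeConjecture.Cruxes.H413.K2E3ParabolicCoarsening

open Literature.NumberTheory.Automorphic K2E3UnitaryParabolicLeviPart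
open scoped Matrix MatrixGroups

variable {R : Type*} [CommRing R] (σ : R →+* R) {n : Type*} [Fintype n] [DecidableEq n]
  {α β : Type*} [LinearOrder α] [LinearOrder β] [Fintype α] [Fintype β] (c : n → α) (c' : n → β)
  (hmono : ∀ k l, c k ≤ c l → c' k ≤ c' l)

/-! ## §1 Coarsening at the level of `GL_n` -/

section GLLevel

include hmono

omit [Fintype n] [DecidableEq n] [Fintype α] [Fintype β] in
/-- Equal fine labels have equal coarse labels. [folklore] -/
theorem eq_of_coarsening {k l : n} (h : c k = c l) : c' k = c' l :=
  le_antisymm (hmono k l h.le) (hmono l k h.ge)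

omit [Fintype n] [DecidableEq n] [Fintype α] [Fintype β] in
/-- A strict coarse inequality forces a strict fine one. [folklore] -/
theorem lt_of_coarsening {k l : n} (h : c' l < c' k) : c l < c k :=
  lt_of_not_ge fun hkl => not_le.2 h (hmono k l hkl)

omit [Fintype α] [Fintype β] in
/-- **`P_S ≤ P_{S'}`**: block triangular for the fine labelling ⇒ for the coarse one. [cite: BernsteinZelevinsky1977, §2.1] -/
theorem standardParabolicGL_le_of_coarsening : standardParabolicGL R c ≤ standardParabolicGL R c' :=
  fun _ hg _ _ hij => hg (lt_of_coarsening c c' hmono hij)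

omit [Fintype α] in
/-- **`M_S ≤ M_{S'}`**: block diagonal for the fine labelling ⇒ for the coarse one. [cite: BernsteinZelevinsky1977, §2.1] -/
theorem standardLeviGL_le_of_coarsening [Fintype α] : standardLeviGL R c ≤ standardLeviGL R c' := by
  intro g hg
  rw [mem_standardLeviGL_iff] at hg ⊢
  exact fun i j hij => hg i j fun h => hij (eq_of_coarsening c c' hmono h)

omit [Fintype α] [Fintype β] in
/-- **`U_{S'} ≤ U_S`**: the radical of the bigger parabolic is contained in that of the smaller. [cite: BernsteinZelevinsky1977, §2.3] -/
theorem unipotentRadicalGL_le_of_coarsening : unipotentRadicalGL R c' ≤ unipotentRadicalGL R c := by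
  intro g hg
  rw [mem_unipotentRadicalGL_iff_entry] at hg ⊢
  obtain ⟨htri, hdiag⟩ := hg
  refine ⟨fun i j hij => ?_, fun i j hij => hdiag i j (eq_of_coarsening c c' hmono hij)⟩
  rcases (hmono j i hij.le).lt_or_eq with hlt | heq
  · exact htri hlt
  · rw [hdiag i j heq.symm, Matrix.one_apply, if_neg (fun h => hij.ne' (congrArg c h))]

omit [Fintype α] in
/-- **The `c'`-Levi part of `u ∈ U_c` lies in `U_c`** (its entries are `[c' i = c' j] · u_{ij}`). [cite: BernsteinZelevinsky1977, §2.3] -/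
theorem leviPart_mem_unipotentRadicalGL_of_coarsening (u : GL n R) (hu : u ∈ unipotentRadicalGL R c)
    (huP : u ∈ standardParabolicGL R c') :
    (leviEmbeddingP R c' (leviProjection R c' ⟨u, huP⟩) : GL n R) ∈ unipotentRadicalGL R c := by
  rw [mem_unipotentRadicalGL_iff_entry] at hu ⊢
  obtain ⟨htri, hdiag⟩ := hu
  refine ⟨fun i j hij => ?_, fun i j hij => ?_⟩
  · rw [coe_leviPart_apply]
    split_ifs
    · exact htri hij
    · rfl
  · rw [coe_leviPart_apply, if_pos (eq_of_coarsening c c' hmono hij)]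
    exact hdiag i j hij

end GLLevel

/-! ## §2 The nest `N_S ∩ U = (N_S ∩ M_{S'} ∩ U) · (N_{S'} ∩ U)` -/

section Nest

variable (J : Matrix n n R)

include hmono

omit [Fintype α] in
/-- **NEST**: for `J` anti-block w.r.t. the COARSE labelling (`J k l ≠ 0 → c' l = τ' (c' k)`), every `n ∈ N_S ∩ U` factors as `n = n'·n''` with
`n' ∈ N_S ∩ M_{S'} ∩ U` (the `c'`-Levi part, unitary by ★ `leviPart_mem_unitaryGroupOfForm`) and `n'' ∈ N_{S'} ∩ U`. [cite: BernsteinZelevinsky1977, §2.3] -/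
theorem exists_nest (τ' : β → β) (hτ' : ∀ a b, a ≤ b → τ' b ≤ τ' a) (hτ'i : Function.Injective τ')
    (hJ' : ∀ k l, J k l ≠ 0 → c' l = τ' (c' k)) (x : ↥(unitaryGroupOfForm σ J))
    (hx : x ∈ (unipotentRadicalGL R c).comap (unitaryGroupOfForm σ J).subtype) :
    ∃ y : ↥(unitaryGroupOfForm σ J), y ∈ (unipotentRadicalGL R c).comap (unitaryGroupOfForm σ J).subtype ∧
      y ∈ (standardLeviGL R c').comap (unitaryGroupOfForm σ J).subtype ∧
      ∃ z : ↥(unitaryGroupOfForm σ J), z ∈ (unipotentRadicalGL R c').comap (unitaryGroupOfForm σ J).subtype ∧ x = y * z := by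
  have hxN : (x : GL n R) ∈ unipotentRadicalGL R c := Subgroup.mem_comap.1 hx
  have hxP : (x : GL n R) ∈ standardParabolicGL R c' :=
    standardParabolicGL_le_of_coarsening c c' hmono (unipotentRadicalGL_le R c hxN)
  set q : ↥(standardParabolicGL R c') := ⟨(x : GL n R), hxP⟩ with hqdef
  have hℓU : (leviEmbeddingP R c' (leviProjection R c' q) : GL n R) ∈ unitaryGroupOfForm σ J :=
    leviPart_mem_unitaryGroupOfForm σ c' τ' hτ' hτ'i J hJ' q x.2
  set y : ↥(unitaryGroupOfForm σ J) := ⟨_, hℓU⟩ with hydef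
  refine ⟨y, ?_, ?_, y⁻¹ * x, ?_, (mul_inv_cancel_left y x).symm⟩
  · exact Subgroup.mem_comap.2 (leviPart_mem_unipotentRadicalGL_of_coarsening c c' hmono _ hxN hxP)
  · exact Subgroup.mem_comap.2 ⟨_, rfl⟩
  · rw [Subgroup.mem_comap, Subgroup.coe_subtype, Subgroup.coe_mul, Subgroup.coe_inv]
    have hker : (leviEmbeddingP R c' (leviProjection R c' q))⁻¹ * q ∈ unipotentRadicalP R c' := by
      rw [MonoidHom.mem_ker, map_mul, map_inv, leviProjection_leviEmbeddingP_apply, inv_mul_cancel]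
    rw [← unipotentRadicalGL_subgroupOf] at hker
    exact Subgroup.mem_subgroupOf.1 hker

omit [Fintype α] in
/-- **NEST in the DRIVER's shape**: for parabolic triples `t'` of `↥U` (the bigger parabolic `S'`: `t'.M = M_{S'} ∩ U`, `t'.N = N_{S'} ∩ U`) and
`s` of `↥t'.M` (the Levi triple of `S ⊆ S'`, with `s.N` = the elements of `M_{S'} ∩ U` lying in `N_S`), every `x ∈ N_S ∩ U` is `n' * n''` with
`n' ∈ s.N`, `n'' ∈ t'.N`. [cite: BernsteinZelevinsky1977, §2.3] [cite: Casselman1995, Prop. 1.4.4] -/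
theorem exists_nest_of_eq (τ' : β → β) (hτ' : ∀ a b, a ≤ b → τ' b ≤ τ' a) (hτ'i : Function.Injective τ')
    (hJ' : ∀ k l, J k l ≠ 0 → c' l = τ' (c' k)) (t' : ParabolicTriple ↥(unitaryGroupOfForm σ J))
    (ht'M : t'.M = (standardLeviGL R c').comap (unitaryGroupOfForm σ J).subtype)
    (ht'N : t'.N = (unipotentRadicalGL R c').comap (unitaryGroupOfForm σ J).subtype) (s : ParabolicTriple ↥t'.M)
    (hsN : ∀ y : ↥t'.M, y ∈ s.N ↔ ((y : ↥(unitaryGroupOfForm σ J)) : GL n R) ∈ unipotentRadicalGL R c)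
    (x : ↥(unitaryGroupOfForm σ J)) (hx : (x : GL n R) ∈ unipotentRadicalGL R c) :
    ∃ n' : ↥t'.M, n' ∈ s.N ∧ ∃ n'' : ↥(unitaryGroupOfForm σ J), n'' ∈ t'.N ∧ x = (n' : ↥(unitaryGroupOfForm σ J)) * n'' := by
  obtain ⟨y, hyN, hyM, z, hz, hxyz⟩ := exists_nest σ c c' hmono J τ' hτ' hτ'i hJ' x (Subgroup.mem_comap.2 hx)
  refine ⟨⟨y, ht'M.symm.le hyM⟩, (hsN _).2 (Subgroup.mem_comap.1 hyN), z, ht'N.symm.le hz, hxyz⟩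

end Nest

/-! ## §3 The Levi triple `P_S ∩ M_{S'} = M_S ⋉ (N_S ∩ M_{S'})` inside `↥(M_{S'} ∩ U)` -/

section LeviTriple

variable (J : Matrix n n R)

include hmono

omit hmono in
/-- `P_S ∩ M_{S'}` normalises `N_S ∩ M_{S'}` inside `↥(M_{S'} ∩ U)` (pulled back from ★ `le_normalizer_parabolic_unitary`). [cite: BernsteinZelevinsky1977, §2.3] -/
theorem le_normalizer_leviTriple :
    (((standardParabolicGL R c).comap (unitaryGroupOfForm σ J).subtype).subgroupOf
        ((standardLeviGL R c').comap (unitaryGroupOfForm σ J).subtype)) ≤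
      Subgroup.normalizer ((((unipotentRadicalGL R c).comap (unitaryGroupOfForm σ J).subtype).subgroupOf
        ((standardLeviGL R c').comap (unitaryGroupOfForm σ J).subtype) :
          Subgroup ↥((standardLeviGL R c').comap (unitaryGroupOfForm σ J).subtype)) :
        Set ↥((standardLeviGL R c').comap (unitaryGroupOfForm σ J).subtype)) := by
  intro p hp
  rw [Subgroup.mem_subgroupOf] at hp
  have hP := le_normalizer_parabolic_unitary σ c J hp
  rw [Subgroup.mem_normalizer_iff] at hP ⊢
  intro x
  simp only [Subgroup.mem_subgroupOf, Subgroup.coe_mul, Subgroup.coe_inv]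
  exact hP (x : ↥(unitaryGroupOfForm σ J))

omit [Fintype α] in
/-- **`P_S ∩ M_{S'} = M_S ⋉ (N_S ∩ M_{S'})` inside `↥(M_{S'} ∩ U)`** (`J` anti-block for the FINE labelling `c`): the `isComplement'` field of the Levi
triple, in `subgroupOf` currency — disjointness from ★ `parabolicTripleGL R c`, decomposition `p = ℓ(p)·(ℓ(p)⁻¹p)` with `ℓ(p)` the `c`-Levi part
(unitary by ★ p855588, in `M_{S'}` by `M_S ≤ M_{S'}`). [cite: BernsteinZelevinsky1977, §2.3] [cite: Casselman1995, Prop. 1.4.4] -/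
theorem isComplement'_leviTriple [Fintype α] (τ : α → α) (hτ : ∀ a b, a ≤ b → τ b ≤ τ a) (hτi : Function.Injective τ)
    (hJ : ∀ k l, J k l ≠ 0 → c l = τ (c k)) :
    ((((standardLeviGL R c).comap (unitaryGroupOfForm σ J).subtype).subgroupOf
        ((standardLeviGL R c').comap (unitaryGroupOfForm σ J).subtype)).subgroupOf
      (((standardParabolicGL R c).comap (unitaryGroupOfForm σ J).subtype).subgroupOf
        ((standardLeviGL R c').comap (unitaryGroupOfForm σ J).subtype))).IsComplement'
    ((((unipotentRadicalGL R c).comap (unitaryGroupOfForm σ J).subtype).subgroupOf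
        ((standardLeviGL R c').comap (unitaryGroupOfForm σ J).subtype)).subgroupOf
      (((standardParabolicGL R c).comap (unitaryGroupOfForm σ J).subtype).subgroupOf
        ((standardLeviGL R c').comap (unitaryGroupOfForm σ J).subtype))) := by
  refine Subgroup.isComplement'_of_disjoint_and_mul_eq_univ ?_ ?_
  · rw [Subgroup.disjoint_def]
    intro x hxM hxN
    simp only [Subgroup.mem_subgroupOf, Subgroup.mem_comap, Subgroup.coe_subtype] at hxM hxN
    have hxP' : ((x.1.1 : ↥(unitaryGroupOfForm σ J)) : GL n R) ∈ standardParabolicGL R c :=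
      Subgroup.mem_comap.1 (Subgroup.mem_subgroupOf.1 x.2)
    have hdis := (parabolicTripleGL R c).isComplement'.disjoint
    rw [Subgroup.disjoint_def] at hdis
    have h1 : (⟨_, hxP'⟩ : ↥(standardParabolicGL R c)) = 1 :=
      hdis (Subgroup.mem_subgroupOf.2 hxM) (Subgroup.mem_subgroupOf.2 hxN)
    have h2 := congrArg Subtype.val h1
    exact Subtype.ext (Subtype.ext (Subtype.ext h2))
  · refine Set.eq_univ_of_forall fun p => ?_
    -- `p : ↥(P_S ∩ M_{S'} ∩ U)` (three coercions down to `GL n R`)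
    set g : ↥(unitaryGroupOfForm σ J) := p.1.1 with hgdef
    have hpP : (g : GL n R) ∈ standardParabolicGL R c := Subgroup.mem_comap.1 (Subgroup.mem_subgroupOf.1 p.2)
    set q : ↥(standardParabolicGL R c) := ⟨(g : GL n R), hpP⟩ with hqdef
    have hℓU : (leviEmbeddingP R c (leviProjection R c q) : GL n R) ∈ unitaryGroupOfForm σ J :=
      leviPart_mem_unitaryGroupOfForm σ c τ hτ hτi J hJ q g.2
    have hℓMc : (leviEmbeddingP R c (leviProjection R c q) : GL n R) ∈ standardLeviGL R c := ⟨_, rfl⟩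
    have hℓMc' : (leviEmbeddingP R c (leviProjection R c q) : GL n R) ∈ standardLeviGL R c' :=
      standardLeviGL_le_of_coarsening c c' hmono hℓMc
    have hℓP : (leviEmbeddingP R c (leviProjection R c q) : GL n R) ∈ standardParabolicGL R c := standardLeviGL_le R c hℓMc
    -- the Levi part as an element of `↥(M_{S'} ∩ U)`, of `P_S ∩ M_{S'}`, of `M_S`
    let ℓU : ↥(unitaryGroupOfForm σ J) := ⟨_, hℓU⟩
    have hℓU' : ℓU ∈ (standardLeviGL R c').comap (unitaryGroupOfForm σ J).subtype := Subgroup.mem_comap.2 hℓMc'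
    let ℓM : ↥((standardLeviGL R c').comap (unitaryGroupOfForm σ J).subtype) := ⟨ℓU, hℓU'⟩
    have hℓMP : ℓM ∈ ((standardParabolicGL R c).comap (unitaryGroupOfForm σ J).subtype).subgroupOf
        ((standardLeviGL R c').comap (unitaryGroupOfForm σ J).subtype) :=
      Subgroup.mem_subgroupOf.2 (Subgroup.mem_comap.2 hℓP)
    let m : ↥(((standardParabolicGL R c).comap (unitaryGroupOfForm σ J).subtype).subgroupOf
        ((standardLeviGL R c').comap (unitaryGroupOfForm σ J).subtype)) := ⟨ℓM, hℓMP⟩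
    refine Set.mem_mul.2 ⟨m, ?_, m⁻¹ * p, ?_, mul_inv_cancel_left _ _⟩
    · simp only [SetLike.mem_coe, Subgroup.mem_subgroupOf, Subgroup.mem_comap, Subgroup.coe_subtype]
      exact hℓMc
    · simp only [SetLike.mem_coe, Subgroup.mem_subgroupOf, Subgroup.mem_comap, Subgroup.coe_subtype, Subgroup.coe_mul, Subgroup.coe_inv]
      have hker : (leviEmbeddingP R c (leviProjection R c q))⁻¹ * q ∈ unipotentRadicalP R c := by
        rw [MonoidHom.mem_ker, map_mul, map_inv, leviProjection_leviEmbeddingP_apply, inv_mul_cancel]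
      rw [← unipotentRadicalGL_subgroupOf] at hker
      exact Subgroup.mem_subgroupOf.1 hker

end LeviTriple

end Summit.HodgeConjecture.HodgeConjecture.Cruxes.H413.K2E3ParabolicCoarsening
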